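import Summits.Ventures.QEC.Thresholds.HGPInstancesBoxThresholds
import Literature.InformationTheory.QuantumCodes.CSSPhenomenologicalDepolarizing
import HarnessLib

/-!
# Hypergraph-product families under PHENOMENOLOGICAL DEPOLARIZING noise (three rates), sector-wise minimum-weight space-time
# decoding: region `p < (3/2)·min(p₀(c₁+q₂+1), p₀(q₁+c₂+1))`, `q_X < p₀(c₁+q₂+1)`, `q_Z < p₀(q₁+c₂+1)`; `(3,4)`-bounded seeds
# `p < (3/2)·p₀(8)`, `q < p₀(8)` — UNCONDITIONAL, kernel

Venture QEC, `Summits/Ventures/QEC/Thresholds/` (LADDER-QEC rung Q5 «families beyond the toric code», PARTITION row 09; qec-type-09 gen 5,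
item 09.PHDEPOL; companion of `CSSFamilyPhenomenologicalDepolarizing.lean`). The two-rate BOXES of `HypergraphProductBoxThresholds.lean` /
`HGPInstancesBoxThresholds.lean` (qec-type-09 gen 4: `HGP.code (H₁ i) (H₂ i)` with seed row/column weights `c₁, q₂` resp. `q₁, c₂`,
sector distances `≥ d i ≥ 1` by Tillich–Zémor Thm 9 inputs, subexponential space-time volume, ANY minimum-weight space-time decoders)
fed to `CSSCode.depolPhenom_belowThreshold_of_boxes` (three-rate law, sector-wise decoding):

| theorem | family | statement |
|---|---|---|
| `hgp_depolPhenom_belowThreshold` | every HGP family with bounded seed degrees | `0 ≤ p < (3/2)·min(p₀(c₁+q₂+1), p₀(q₁+c₂+1))` (`p ≤ 1`), `0 ≤ q_X < p₀(c₁+q₂+1)`, `0 ≤ q_Z < p₀(q₁+c₂+1)` (`≤ 1`) ⇒ `P_fail → 0` |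
| `gallager34_depolPhenom_belowThreshold` | `(3,4)`-bounded seeds both sides | `0 ≤ p < (3/2)·p₀(8)`, `0 ≤ q_X, q_Z < p₀(8)` ⇒ `P_fail → 0` |

All UNCONDITIONAL, tier CERTIFIED (kernel), axioms standard, 0 named facts; certified LOWER bounds on the region for sector-wise
(correlation-blind) minimum-weight space-time decoding. Theorem-only file.

## References

* [TillichZemor2014] J.-P. Tillich, G. Zémor, IEEE Trans. IT 60 (2014) 1193, Thm 9 (sector distances of hypergraph products).
* [DumerKovalevPryadko2015] I. Dumer, A. A. Kovalev, L. P. Pryadko, PRL 115 (2015) 050502, Thm 3 with p. 5, eq. (succesful-decoding-depolarizing).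
* [AliferisGottesmanPreskill2006] P. Aliferis, D. Gottesman, J. Preskill, arXiv:quant-ph/0504218, §8.2 (chunk p0026 L11: depolarizing).
-/

noncomputable section

namespace Summit.Ventures.QEC.Thresholds

open Filter Topology Finset Matrix
open Literature.InformationTheory.QuantumCodes
open Literature.InformationTheory.Coding (minDist)

section Family

variable {m₁ n₁ m₂ n₂ : ℕ → ℕ}

/-- **Hypergraph-product families under phenomenological depolarizing noise** (seeds `H₁ i`, `H₂ i` with row weights `≤ c₁`, `≤ c₂`
and column weights `≤ q₁`, `≤ q₂`; both sector distances `≥ d i ≥ 1`; subexponential space-time volumes; ANY pair of minimum-weight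
space-time decoders): `0 ≤ p < (3/2)·min(p₀(c₁+q₂+1), p₀(q₁+c₂+1))`, `p ≤ 1`, `0 ≤ q_X < p₀(c₁+q₂+1)`, `0 ≤ q_Z < p₀(q₁+c₂+1)`,
`q_X, q_Z ≤ 1` ⇒ `P_fail → 0`. UNCONDITIONAL. [cite: DumerKovalevPryadko2015, Thm 3 with p. 5 and eq. (succesful-decoding-depolarizing)]
[cite: TillichZemor2014, Thm 9] [cite: AliferisGottesmanPreskill2006, §8.2 (chunk p0026 L11)] -/
theorem hgp_depolPhenom_belowThreshold (H₁ : ∀ i, Matrix (Fin (m₁ i)) (Fin (n₁ i)) (ZMod 2))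
    (H₂ : ∀ i, Matrix (Fin (m₂ i)) (Fin (n₂ i)) (ZMod 2)) (T : ℕ → ℕ)
    (DZ : ∀ i, CSSPhenom.STDecoder (Fin (m₁ i) × Fin (n₂ i))
      ((Fin (n₁ i) × Fin (n₂ i)) ⊕ (Fin (m₁ i) × Fin (m₂ i))) (T i))
    (DX : ∀ i, CSSPhenom.STDecoder (Fin (n₁ i) × Fin (m₂ i))
      ((Fin (n₁ i) × Fin (n₂ i)) ⊕ (Fin (m₁ i) × Fin (m₂ i))) (T i))
    (hDZ : ∀ i, (DZ i).IsMinWeight (CSSPhenom.stSyn (HGP.code (H₁ i) (H₂ i)).HX (T i))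
      (CSSPhenom.stCycles (HGP.code (H₁ i) (H₂ i)).HX (T i)) hammingNorm)
    (hDX : ∀ i, (DX i).IsMinWeight (CSSPhenom.stSyn (HGP.code (H₁ i) (H₂ i)).HZ (T i))
      (CSSPhenom.stCycles (HGP.code (H₁ i) (H₂ i)).HZ (T i)) hammingNorm)
    {c₁ q₁ c₂ q₂ : ℕ} (hc₁ : ∀ i a, hammingNorm (H₁ i a) ≤ c₁) (hq₁ : ∀ i j, hammingNorm (fun a => H₁ i a j) ≤ q₁)
    (hc₂ : ∀ i b, hammingNorm (H₂ i b) ≤ c₂) (hq₂ : ∀ i j, hammingNorm (fun b => H₂ i b j) ≤ q₂)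
    (d : ℕ → ℕ) (hd1 : ∀ i, 1 ≤ d i)
    (hd₁ : ∀ i, (d i : ℕ∞) ≤ minDist (pcCode (H₁ i))) (hd₁' : ∀ i, (d i : ℕ∞) ≤ minDist (pcCode (H₁ i)ᵀ))
    (hd₂ : ∀ i, (d i : ℕ∞) ≤ minDist (pcCode (H₂ i))) (hd₂' : ∀ i, (d i : ℕ∞) ≤ minDist (pcCode (H₂ i)ᵀ))
    (hgrowthZ : ∀ r : ℝ, 0 < r → r < 1 →
      Tendsto (fun i => (((n₁ i * n₂ i + m₁ i * m₂ i + m₁ i * n₂ i) * T i : ℕ) : ℝ) * r ^ d i) atTop (𝓝 0))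
    (hgrowthX : ∀ r : ℝ, 0 < r → r < 1 →
      Tendsto (fun i => (((n₁ i * n₂ i + m₁ i * m₂ i + n₁ i * m₂ i) * T i : ℕ) : ℝ) * r ^ d i) atTop (𝓝 0))
    {p qX qZ : ℝ} (hp0 : 0 ≤ p) (hp1 : p ≤ 1)
    (hp : p < 3 / 2 * min (thresholdValue ((c₁ + q₂ + 1 : ℕ) : ℝ)) (thresholdValue ((q₁ + c₂ + 1 : ℕ) : ℝ)))
    (hqX0 : 0 ≤ qX) (hqX1 : qX ≤ 1) (hqX : qX < thresholdValue ((c₁ + q₂ + 1 : ℕ) : ℝ))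
    (hqZ0 : 0 ≤ qZ) (hqZ1 : qZ ≤ 1) (hqZ : qZ < thresholdValue ((q₁ + c₂ + 1 : ℕ) : ℝ)) :
    Tendsto (fun i => (HGP.code (H₁ i) (H₂ i)).depolPhenomFailureProb (T i) (DZ i) (DX i) p qX qZ) atTop (𝓝 0) :=
  CSSCode.depolPhenom_belowThreshold_of_boxes (fun i => HGP.code (H₁ i) (H₂ i)) T DZ DX
    (hgp_z_phenom_isThresholdBoxLowerBound H₁ H₂ T DZ hDZ hc₁ hq₂ d hd1 hd₁ hd₂' hgrowthZ)
    (hgp_x_phenom_isThresholdBoxLowerBound H₁ H₂ T DX hDX hq₁ hc₂ d hd1 hd₁' hd₂ hgrowthX)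
    hp0 hp1 hp hqX0 hqX1 hqX hqZ0 hqZ1 hqZ

/-- **`(3,4)`-bounded seeds on both sides** (space-time check weight `7 + 2`): `0 ≤ p < (3/2)·p₀(8)`, `0 ≤ q_X, q_Z < p₀(8)` ⇒
`P_fail → 0` under the three-rate law, sector-wise minimum-weight space-time decoding. UNCONDITIONAL.
[cite: DumerKovalevPryadko2015, Thm 3 with p. 5] [cite: TillichZemor2014, Thm 9] -/
theorem gallager34_depolPhenom_belowThreshold (H₁ : ∀ i, Matrix (Fin (m₁ i)) (Fin (n₁ i)) (ZMod 2))
    (H₂ : ∀ i, Matrix (Fin (m₂ i)) (Fin (n₂ i)) (ZMod 2))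
    (hB₁ : ∀ i, IsDegreeBounded (H₁ i) 3 4) (hB₂ : ∀ i, IsDegreeBounded (H₂ i) 3 4) (T : ℕ → ℕ)
    (DZ : ∀ i, CSSPhenom.STDecoder (Fin (m₁ i) × Fin (n₂ i))
      ((Fin (n₁ i) × Fin (n₂ i)) ⊕ (Fin (m₁ i) × Fin (m₂ i))) (T i))
    (DX : ∀ i, CSSPhenom.STDecoder (Fin (n₁ i) × Fin (m₂ i))
      ((Fin (n₁ i) × Fin (n₂ i)) ⊕ (Fin (m₁ i) × Fin (m₂ i))) (T i))
    (hDZ : ∀ i, (DZ i).IsMinWeight (CSSPhenom.stSyn (HGP.code (H₁ i) (H₂ i)).HX (T i))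
      (CSSPhenom.stCycles (HGP.code (H₁ i) (H₂ i)).HX (T i)) hammingNorm)
    (hDX : ∀ i, (DX i).IsMinWeight (CSSPhenom.stSyn (HGP.code (H₁ i) (H₂ i)).HZ (T i))
      (CSSPhenom.stCycles (HGP.code (H₁ i) (H₂ i)).HZ (T i)) hammingNorm)
    (d : ℕ → ℕ) (hd1 : ∀ i, 1 ≤ d i)
    (hd₁ : ∀ i, (d i : ℕ∞) ≤ minDist (pcCode (H₁ i))) (hd₁' : ∀ i, (d i : ℕ∞) ≤ minDist (pcCode (H₁ i)ᵀ))
    (hd₂ : ∀ i, (d i : ℕ∞) ≤ minDist (pcCode (H₂ i))) (hd₂' : ∀ i, (d i : ℕ∞) ≤ minDist (pcCode (H₂ i)ᵀ))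
    (hgrowthZ : ∀ r : ℝ, 0 < r → r < 1 →
      Tendsto (fun i => (((n₁ i * n₂ i + m₁ i * m₂ i + m₁ i * n₂ i) * T i : ℕ) : ℝ) * r ^ d i) atTop (𝓝 0))
    (hgrowthX : ∀ r : ℝ, 0 < r → r < 1 →
      Tendsto (fun i => (((n₁ i * n₂ i + m₁ i * m₂ i + n₁ i * m₂ i) * T i : ℕ) : ℝ) * r ^ d i) atTop (𝓝 0))
    {p qX qZ : ℝ} (hp0 : 0 ≤ p) (hp : p < 3 / 2 * thresholdValue 8) (hqX0 : 0 ≤ qX) (hqX : qX < thresholdValue 8)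
    (hqZ0 : 0 ≤ qZ) (hqZ : qZ < thresholdValue 8) :
    Tendsto (fun i => (HGP.code (H₁ i) (H₂ i)).depolPhenomFailureProb (T i) (DZ i) (DX i) p qX qZ) atTop (𝓝 0) := by
  have hv : thresholdValue (8 : ℝ) ≤ 1 / 2 := thresholdValue_le_half _
  exact CSSCode.depolPhenom_belowThreshold_of_box (fun i => HGP.code (H₁ i) (H₂ i)) T DZ DX
    (gallager34_z_phenom_isThresholdBoxLowerBound H₁ H₂ hB₁ hB₂ T DZ hDZ d hd1 hd₁ hd₂' hgrowthZ)
    (gallager34_x_phenom_isThresholdBoxLowerBound H₁ H₂ hB₁ hB₂ T DX hDX d hd1 hd₁' hd₂ hgrowthX)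
    hp0 (by linarith) hp hqX0 (by linarith) hqX hqZ0 (by linarith) hqZ

end Family

end Summit.Ventures.QEC.Thresholds

end
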